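import Summits.BirchSwinnertonDyer.BirchSwinnertonDyer.Theorems.KolyvaginRankRigidityAtTwoKolyvaginBoundedDefectAtTwoDepthZero
import Summits.BirchSwinnertonDyer.BirchSwinnertonDyer.Theorems.KolyvaginRankRigidityAtTwoKolyvaginCorankLowerBoundAtTwoMarginChebotarevOneClassIndexAtTwo
import Summits.BirchSwinnertonDyer.BirchSwinnertonDyer.Theorems.GenusKolyvaginAtTwoKolyvaginRelationAtTwo
import Summits.BirchSwinnertonDyer.BirchSwinnertonDyer.Theorems.Rank1ResidualJetCompatibleData
import Literature.NumberTheory.EllipticCurves.HeegnerPointsOfConductorRationalityProofs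
import HarnessLib

/-!
# Crux U1 `KolyvaginBoundedDefectAtTwo` (stmt-BirchSwinnertonDyer-28083; LINE 14 seed half of V1′∞ 27983):
# KOLYVAGIN'S PROPAGATION AT 2 — bounded defect at depth `r` ⇒ bounded defect at depth `r + 1` (losing `c₁` bits),
# modulo Gross 1991 Prop. 3.7 (2); corollary: `y_K` of infinite order ⇒ bounded defect at EVERY depth

Width seat `bsd-line-krr2-p2` g8 (critic #110 price (2): «first target beyond r = 0 — the r = 1 defect bound from a single
Kolyvagin prime via Gross 3.7(2)-at-2 + the Čebotarev bits»). Kolyvagin's monotonicity `m_{r+1} ≤ m_r` (Math. Ann. 291 §2;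
Jetchev 2008 §4: «ℳ_{r+1} ≤ ℳ_r») at the prime `2`, in U1's bounded-defect currency, at arbitrarily deep levels:
from `2^(M−m−1)·c_M(n) ≠ 0` (depth `r`, `M ≤ M(n)`, any `M > m + c₁`),
* S2 `stub_chebotarevOneClassIndexAtTwo` (krr2-p2 g6, `c₁ = 2`, p621465) gives a FRESH Kolyvagin prime `q ∤ n` of index
  `≥ M` and a place `λ ∣ q` with `2^(M−m−1−c₁)·c_M(n) ∉ ker loc_λ`;
* `JET.exists_compatible_data_of_grossCM` (bsd-jet, with the PROVED Gross §3 CM fact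
  `phi_heegnerPointOfConductor_mem_range_map_ringClassField_holds`) gives a datum at `n·q` compatible with the given one in
  McCallum's four clauses;
* Q2 `KolyvaginRelationAtTwo` (GK2 stmt-24880) — the landed `GenusExact.kolyvaginRelationAtTwo_of_frobeniusCongruence h37`
  (McCallum Prop. 4.4 «in particular» at `2` from Gross 3.7 (2)) — carries the local non-triviality to `c_M(nq)` at `λ`:
  `2^(M−m−1−c₁)·c_M(nq) ≠ 0`, depth `r + 1`, `M ≤ M(nq)`.
`boundedDefectAtTwo_depth_succ_of_prop37`: U1's per-depth clause at `(r, m)` ⇒ at `(r+1, m+c₁)`;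
`boundedDefectAtTwo_allDepths_of_nonTorsion_of_prop37`: with the depth-zero rung (`…BoundedDefectAtTwoDepthZero`,
unconditional), `P(1)` of infinite order ⇒ bounded defect at every depth `r` (defect `m₀ + r·c₁`).
HONEST FRAMING: CONDITIONAL on the cite-only print fact `GrossLMS1991.prop37_2_frobeniusCongruence` (D-0014); the content of
U1 — the torsion-`y_K` frames, Kolyvagin's conjecture at `2` — is NOT touched (propagation starts from a non-zero class; it
does not create one); `--supports stmt-BirchSwinnertonDyer-28083`; BSD is NOT proved by any of this.
References: [Kolyvagin1991MathAnn] §2 (p. 257); [McCallumLMS1991] §4 Prop. 4.4, §5 Prop. 5.2; [GrossLMS1991] §3, Prop. 3.7 (2),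
§4 (4.1); [Jetchev2008] §4 (ℳ_{r+1} ≤ ℳ_r).
-/

set_option autoImplicit false
-- the Theorems namespace of this sub repeats the summit name by design (D-0017 nested layout)
set_option linter.dupNamespace false

noncomputable section

open scoped Classical

open WeierstrassCurve Field Literature.NumberTheory.EllipticCurves
  Literature.NumberTheory.EllipticCurves.ModularForms NumberField IsDedekindDomain
open Summit.BirchSwinnertonDyer.BirchSwinnertonDyer.Theses.KolyvaginRankRigidityAtTwo
open Summit.BirchSwinnertonDyer.BirchSwinnertonDyer.Theses.GenusKolyvaginAtTwo (KolyvaginRelationAtTwo)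
open Literature.NumberTheory.EllipticCurves.GrossLMS1991 (prop37_2_frobeniusCongruence)
open Summit.BirchSwinnertonDyer.BirchSwinnertonDyer.Theorems.KolyvaginLowerBoundAtTwo
  (stub_chebotarevOneClassIndexAtTwo)

namespace Summit.BirchSwinnertonDyer.BirchSwinnertonDyer.Theorems.KolyvaginAtTwo

/-- Cast bookkeeping: `((2^k : ℕ) : ℤ) = (2 : ℤ)^k`. [folklore] -/
private theorem natCast_two_pow (k : ℕ) : ((2 ^ k : ℕ) : ℤ) = (2 : ℤ) ^ k := by push_cast; rfl

/-- **Kolyvagin's PROPAGATION at `2` (one fresh prime), modulo Q2**: on the V1′∞ frame, U1's per-depth clause at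
`(r, m)` — at every level `M > m` a depth-`r` conductor `n` with `M ≤ M(n)` and `2^(M−m−1)·c_M(n) ≠ 0` — implies the
clause at `(r + 1, m + c₁)`, `c₁` the constant of S2 (pair Čebotarev at `2`, order-free shape). The new conductor is
`n·q` for a fresh Kolyvagin prime `q` of index `≥ M` seeing `2^(M−m−1−c₁)·c_M(n)` locally (S2); the datum at `n·q` is
bsd-jet's compatible extension; the local order passes to `c_M(nq)` by Q2 `KolyvaginRelationAtTwo`.
[cite: Kolyvagin1991MathAnn, §2, p. 257] [cite: McCallumLMS1991, §4 Prop. 4.4, §5 Prop. 5.2] [cite: Jetchev2008, §4] -/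
theorem boundedDefectAtTwo_depth_succ_of_Q2 (hQ2 : KolyvaginRelationAtTwo) :
    ∀ (W : WeierstrassCurve ℚ) [W.IsElliptic] [W.IsGloballyMinimal], ¬ W.HasCM →
      (Literature.NumberTheory.EllipticCurves.Rank1Residual.GoodOrd W 2 ∨
        Literature.NumberTheory.EllipticCurves.Rank1Residual.Mult W 2) →
      (∀ m : ℕ, W.HasSurjectiveModNGaloisRep (2 ^ m : ℕ)) →
      ∀ (K : Type) [Field K] [NumberField K], Literature.NumberTheory.EllipticCurves.IsImaginaryQuadratic K →
      ∀ [NeZero (W.conductorNorm ℤ)],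
      Literature.NumberTheory.EllipticCurves.SatisfiesHeegnerHypothesis (W.conductorNorm ℤ) K →
      Odd (NumberField.discr K) → NumberField.discr K ≠ -3 →
      AddSubgroup.torsionBy (W.baseChange K).toAffine.Point (2 : ℤ) = ⊥ →
      Literature.NumberTheory.EllipticCurves.SatisfiesHeegnerHypothesis 2 K →
      ∀ (Dt : Literature.NumberTheory.EllipticCurves.ModularForms.ModularParametrizationData W (W.conductorNorm ℤ))
        (β : ℤ) (ι : K →+* ℂ), (4 * (W.conductorNorm ℤ : ℤ)) ∣ β ^ 2 - NumberField.discr K →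
      ∃ c₁ : ℕ, ∀ r m : ℕ,
        (∀ M : ℕ, m < M →
          ∃ (n : ℕ) (d : Literature.NumberTheory.EllipticCurves.KolyvaginHeegnerData Dt β ι n),
            Literature.NumberTheory.EllipticCurves.KolyvaginDescent.KolSupp
              (Literature.NumberTheory.EllipticCurves.Zhang2014.IsKolyvaginPrime (W.conductorNorm ℤ) W K 2) n ∧
            n.primeFactors.card = r ∧
            ((M : ℕ) : ℕ∞) ≤ Literature.NumberTheory.EllipticCurves.Zhang2014.levelIndex W 2 n ∧
            (2 ^ (M - m - 1) : ℤ) • d.kolyvaginClass Nat.prime_two M ≠ 0) →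
        ∀ M : ℕ, m + c₁ < M →
          ∃ (n : ℕ) (d : Literature.NumberTheory.EllipticCurves.KolyvaginHeegnerData Dt β ι n),
            Literature.NumberTheory.EllipticCurves.KolyvaginDescent.KolSupp
              (Literature.NumberTheory.EllipticCurves.Zhang2014.IsKolyvaginPrime (W.conductorNorm ℤ) W K 2) n ∧
            n.primeFactors.card = r + 1 ∧
            ((M : ℕ) : ℕ∞) ≤ Literature.NumberTheory.EllipticCurves.Zhang2014.levelIndex W 2 n ∧
            (2 ^ (M - (m + c₁) - 1) : ℤ) • d.kolyvaginClass Nat.prime_two M ≠ 0 := by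
  intro W _ _ hCM hred hsur K _ _ hK _ hHN hodd hne3 _ _ Dt β ι _
  set N := W.conductorNorm ℤ with hN
  -- the habitat in S2's / Q2's spelling
  have h2d : ¬ ((2 : ℤ) ∣ NumberField.discr K) := fun h ↦
    (Int.not_even_iff_odd.mpr hodd) (even_iff_two_dvd.mpr h)
  have hne4 : NumberField.discr K ≠ -4 := fun h ↦ h2d (by rw [h]; norm_num)
  have hD : NumberField.discr K < -4 :=
    Summit.BirchSwinnertonDyer.Rank1Residual.X11b.KolyvaginAssembly.discr_lt_neg_four hK ⟨hne3, hne4⟩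
  obtain ⟨c₁, hS2⟩ := stub_chebotarevOneClassIndexAtTwo W hCM hred hsur K hK hne3 hne4 h2d hHN
  refine ⟨c₁, fun r m hU M hM ↦ ?_⟩
  obtain ⟨n, d, hn, hcard, hlev, hne⟩ := hU M (by omega)
  have hn0 : n ≠ 0 := hn.1.ne_zero
  have hM1 : 1 ≤ M := by omega
  -- the given class is `2^(M-m-1)`-large, `M - m - 1 ≥ c₁`
  have hne' : ((2 ^ (M - m - 1) : ℕ) : ℤ) • d.kolyvaginClass Nat.prime_two M ≠ 0 := by
    rw [natCast_two_pow (M - m - 1)]; exact hne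
  -- S2: a fresh Kolyvagin prime `q ∤ n` of index `≥ M` and a place `v ∣ q` seeing `2^(M-m-1-c₁) c_M(n)`
  obtain ⟨q, hqX, hqKol, hqI, v, hv, hloc⟩ :=
    hS2 Dt β ι n d M (M - m - 1) M hn hM1 hlev le_rfl (by omega) hne' n.primeFactors
  have hq : q.Prime := hqKol.1
  have hqn : ¬ q ∣ n := fun h ↦ hqX (Nat.mem_primeFactors.mpr ⟨hq, h, hn0⟩)
  have hnq : Squarefree (n * q) :=
    (Nat.squarefree_mul ((Nat.Prime.coprime_iff_not_dvd hq).mpr hqn).symm).mpr ⟨hn.1, hq.squarefree⟩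
  have hpf : (n * q).primeFactors = n.primeFactors ∪ {q} := by
    rw [Nat.primeFactors_mul hn0 hq.ne_zero, hq.primeFactors]
  have hKolall : ∀ l' ∈ (n * q).primeFactors, Zhang2014.IsKolyvaginPrime N W K 2 l' ∧
      M ≤ Zhang2014.kolyvaginIndex W 2 l' := by
    intro l' hl'
    rw [hpf, Finset.mem_union, Finset.mem_singleton] at hl'
    rcases hl' with h | rfl
    · exact ⟨hn.2 l' h, (Zhang2014.natCast_le_levelIndex_iff.mp hlev) l' h⟩
    · exact ⟨hqKol, hqI⟩
  -- a datum at `n q` compatible with `d` (bsd-jet, Gross §3 CM fact PROVED)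
  obtain ⟨dℓ, hdℓ⟩ := Summit.BirchSwinnertonDyer.Rank1Residual.JET.exists_compatible_data_of_grossCM
    (phi_heegnerPointOfConductor_mem_range_map_ringClassField_holds N W K) hK hD hHN 2 Dt β ι hn.1 hn.2 d
  obtain ⟨hσ, hS, hS', hemb⟩ := hdℓ q hqKol hqX
  set d' := dℓ q hqKol hqX with hd'
  -- Q2 at `λ ∣ q`: the local (non-)triviality of `2^j c_M(nq)` is that of `2^j c_M(n)`
  have hrel := hQ2 W hCM K hK hne3 hne4 hHN hsur Dt β ι M hM1 n q hnq hq hqn hKolall d d' hσ hS hS' hemb v hv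
    (M - m - 1 - c₁)
  have hloc' : ((2 ^ (M - m - 1 - c₁) : ℕ) : ℤ) • d'.kolyvaginClass Nat.prime_two M ∉
      (W.baseChange K).torsionLocalKer (v.adicCompletion K) ((2 ^ M : ℕ) : ℤ) :=
    fun h ↦ hloc (hrel.2.mp h)
  -- read off
  refine ⟨n * q, d', ⟨hnq, fun l' hl' ↦ (hKolall l' hl').1⟩, ?_, ?_, ?_⟩
  · rw [hpf, Finset.card_union_of_disjoint (Finset.disjoint_singleton_right.mpr hqX), hcard,
      Finset.card_singleton]
  · exact Zhang2014.natCast_le_levelIndex_iff.mpr fun l' hl' ↦ (hKolall l' hl').2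
  · have hj : M - (m + c₁) - 1 = M - m - 1 - c₁ := by omega
    rw [hj, ← natCast_two_pow (M - m - 1 - c₁)]
    intro h0
    exact hloc' (by rw [h0]; exact zero_mem _)

/-- **Kolyvagin's PROPAGATION at `2`, modulo Gross 1991 Prop. 3.7 (2) ONLY**: `boundedDefectAtTwo_depth_succ_of_Q2` with Q2
:= the landed `GenusExact.kolyvaginRelationAtTwo_of_frobeniusCongruence h37`. CONDITIONAL on the cite-only print fact
(D-0014). [cite: GrossLMS1991, Prop. 3.7 (2)] [cite: McCallumLMS1991, §4 Prop. 4.4] [cite: Kolyvagin1991MathAnn, §2] -/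
theorem boundedDefectAtTwo_depth_succ_of_prop37 (h37 : prop37_2_frobeniusCongruence) :
    ∀ (W : WeierstrassCurve ℚ) [W.IsElliptic] [W.IsGloballyMinimal], ¬ W.HasCM →
      (Literature.NumberTheory.EllipticCurves.Rank1Residual.GoodOrd W 2 ∨
        Literature.NumberTheory.EllipticCurves.Rank1Residual.Mult W 2) →
      (∀ m : ℕ, W.HasSurjectiveModNGaloisRep (2 ^ m : ℕ)) →
      ∀ (K : Type) [Field K] [NumberField K], Literature.NumberTheory.EllipticCurves.IsImaginaryQuadratic K →
      ∀ [NeZero (W.conductorNorm ℤ)],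
      Literature.NumberTheory.EllipticCurves.SatisfiesHeegnerHypothesis (W.conductorNorm ℤ) K →
      Odd (NumberField.discr K) → NumberField.discr K ≠ -3 →
      AddSubgroup.torsionBy (W.baseChange K).toAffine.Point (2 : ℤ) = ⊥ →
      Literature.NumberTheory.EllipticCurves.SatisfiesHeegnerHypothesis 2 K →
      ∀ (Dt : Literature.NumberTheory.EllipticCurves.ModularForms.ModularParametrizationData W (W.conductorNorm ℤ))
        (β : ℤ) (ι : K →+* ℂ), (4 * (W.conductorNorm ℤ : ℤ)) ∣ β ^ 2 - NumberField.discr K →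
      ∃ c₁ : ℕ, ∀ r m : ℕ,
        (∀ M : ℕ, m < M →
          ∃ (n : ℕ) (d : Literature.NumberTheory.EllipticCurves.KolyvaginHeegnerData Dt β ι n),
            Literature.NumberTheory.EllipticCurves.KolyvaginDescent.KolSupp
              (Literature.NumberTheory.EllipticCurves.Zhang2014.IsKolyvaginPrime (W.conductorNorm ℤ) W K 2) n ∧
            n.primeFactors.card = r ∧
            ((M : ℕ) : ℕ∞) ≤ Literature.NumberTheory.EllipticCurves.Zhang2014.levelIndex W 2 n ∧
            (2 ^ (M - m - 1) : ℤ) • d.kolyvaginClass Nat.prime_two M ≠ 0) →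
        ∀ M : ℕ, m + c₁ < M →
          ∃ (n : ℕ) (d : Literature.NumberTheory.EllipticCurves.KolyvaginHeegnerData Dt β ι n),
            Literature.NumberTheory.EllipticCurves.KolyvaginDescent.KolSupp
              (Literature.NumberTheory.EllipticCurves.Zhang2014.IsKolyvaginPrime (W.conductorNorm ℤ) W K 2) n ∧
            n.primeFactors.card = r + 1 ∧
            ((M : ℕ) : ℕ∞) ≤ Literature.NumberTheory.EllipticCurves.Zhang2014.levelIndex W 2 n ∧
            (2 ^ (M - (m + c₁) - 1) : ℤ) • d.kolyvaginClass Nat.prime_two M ≠ 0 :=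
  boundedDefectAtTwo_depth_succ_of_Q2 (GenusExact.kolyvaginRelationAtTwo_of_frobeniusCongruence h37)

/-- **`y_K` of infinite order ⇒ bounded defect at EVERY depth** (modulo Gross 3.7 (2)): on the V1′∞ frame with some
conductor-`1` datum whose `P(1)` has infinite order, for every depth `r` there is a defect bound `m` (namely
`m₀ + r·c₁`, `2^(m₀) ∥ P(1)`) such that at every level `M > m` some depth-`r` Kolyvagin conductor `n` with `M ≤ M(n)`
carries `2^(M−m−1)·c_M(n) ≠ 0` — U1's conclusion at every prescribed depth, not just one. Induction on `r`: the
depth-zero rung `boundedDefectAtTwo_depthZero_of_nonTorsion` (unconditional) and the propagation step. The torsion-`y_K`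
frames (Kolyvagin's conjecture at `2`) are NOT touched. [cite: Kolyvagin1991MathAnn, §2 (m_{r+1} ≤ m_r), p. 259 (2.1)]
[cite: McCallumLMS1991, §5 Prop. 5.2] [cite: GrossLMS1991, Prop. 3.7 (2)] -/
theorem boundedDefectAtTwo_allDepths_of_nonTorsion_of_prop37 (h37 : prop37_2_frobeniusCongruence) :
    ∀ (W : WeierstrassCurve ℚ) [W.IsElliptic] [W.IsGloballyMinimal], ¬ W.HasCM →
      (Literature.NumberTheory.EllipticCurves.Rank1Residual.GoodOrd W 2 ∨
        Literature.NumberTheory.EllipticCurves.Rank1Residual.Mult W 2) →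
      (∀ m : ℕ, W.HasSurjectiveModNGaloisRep (2 ^ m : ℕ)) →
      ∀ (K : Type) [Field K] [NumberField K], Literature.NumberTheory.EllipticCurves.IsImaginaryQuadratic K →
      ∀ [NeZero (W.conductorNorm ℤ)],
      Literature.NumberTheory.EllipticCurves.SatisfiesHeegnerHypothesis (W.conductorNorm ℤ) K →
      Odd (NumberField.discr K) → NumberField.discr K ≠ -3 →
      AddSubgroup.torsionBy (W.baseChange K).toAffine.Point (2 : ℤ) = ⊥ →
      Literature.NumberTheory.EllipticCurves.SatisfiesHeegnerHypothesis 2 K →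
      ∀ (Dt : Literature.NumberTheory.EllipticCurves.ModularForms.ModularParametrizationData W (W.conductorNorm ℤ))
        (β : ℤ) (ι : K →+* ℂ), (4 * (W.conductorNorm ℤ : ℤ)) ∣ β ^ 2 - NumberField.discr K →
      (∃ d₁ : Literature.NumberTheory.EllipticCurves.KolyvaginHeegnerData Dt β ι 1, ¬ IsOfFinAddOrder d₁.derivedPoint) →
      ∀ r : ℕ, ∃ m : ℕ, ∀ M : ℕ, m < M →
        ∃ (n : ℕ) (d : Literature.NumberTheory.EllipticCurves.KolyvaginHeegnerData Dt β ι n),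
          Literature.NumberTheory.EllipticCurves.KolyvaginDescent.KolSupp
            (Literature.NumberTheory.EllipticCurves.Zhang2014.IsKolyvaginPrime (W.conductorNorm ℤ) W K 2) n ∧
          n.primeFactors.card = r ∧
          ((M : ℕ) : ℕ∞) ≤ Literature.NumberTheory.EllipticCurves.Zhang2014.levelIndex W 2 n ∧
          (2 ^ (M - m - 1) : ℤ) • d.kolyvaginClass Nat.prime_two M ≠ 0 := by
  intro W _ _ hCM hred hsur K _ _ hK _ hHN hodd hne3 htor hH2 Dt β ι hβ hex r
  obtain ⟨c₁, hstep⟩ := boundedDefectAtTwo_depth_succ_of_prop37 h37 W hCM hred hsur K hK hHN hodd hne3 htor hH2 Dt β ι hβ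
  induction r with
  | zero =>
    exact boundedDefectAtTwo_depthZero_of_nonTorsion W hCM hred hsur K hK hHN hodd hne3 htor hH2 Dt β ι hβ hex
  | succ r ih =>
    obtain ⟨m, hm⟩ := ih
    exact ⟨m + c₁, hstep r m hm⟩

end Summit.BirchSwinnertonDyer.BirchSwinnertonDyer.Theorems.KolyvaginAtTwo

end
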